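import Mathlib
import HarnessLib
import Summits.Ventures.LatticeQCDFlow.Exactness.NCMCGeneralSpaceRestartChainCLT
import Summits.Ventures.LatticeQCDFlow.Exactness.NCMCGeneralSpaceRestartChainVarianceDichotomyLanes
import Summits.Ventures.LatticeQCDFlow.Exactness.NCMCGeneralSpaceRestartChainEveryStart
import Summits.Ventures.LatticeQCDFlow.Exactness.NCMCGeneralSpaceEstimatorConsistency
import Summits.Ventures.LatticeQCDFlow.Exactness.NCMCGeneralSpaceReplicaTStatisticIndep
import Summits.Ventures.LatticeQCDFlow.Exactness.NCMCGeneralSpaceReplicaJackknifeRatio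

/-!
# `reweighted_mean`'s POOLED `⟨O⟩ ± q·err` over `R ≥ 2` independent streams of correlated launches has limiting coverage `L_R(q)` (the delete-one-stream jackknife of the pooled ratio `Σ e^{−W} f(e) / Σ e^{−W}`)

HONEST FRAMING: exact (Metropolis-corrected) sampling algorithms for lattice gauge theory;
figures of merit are autocorrelation/cost numbers at stated couplings and volumes; no
continuum-physics claim.

Venture `LatticeQCDFlow` (cell pub-lqcd), topic `Exactness`; FANOUT row 13 (`eng-snf`, GEN-25).
NEW WORK of the cell: the engine-side instance of GEN-25's `NCMCGeneralSpaceReplicaJackknifeRatio`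
(pooled-ratio jackknife ⇒ `L_R(q)`) along GEN-22's restart chain: the CLT for the time average of
the bounded record observable `c = e^{−W}(f∘e − μ_f)` from every initial record law
(`CrooksPair.tendstoInDistribution_timeAverage_restartChain`), `E_F c = 0` (reweighting identity
`integral_exp_neg_work_mul_comp_end`), GEN-23 V2 `reweightVariance_pos_iff` (variance dichotomy),
`tendsto_sampleMean_restartChain_anyLaw` (the mean weight converges a.s.) and GEN-23
`tendstoInDistribution_pi_toLp` (independent streams).  Not a published result; no definition;
nothing cited as a fact.

WHY (row 13). GEN-24 J2 (`…ReplicaReweightedJackknife`) typed the bar of the MEAN OF PER-STREAM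
RATIOS. `estimators.reweighted_mean` run on the concatenated records of `R` streams with `block_ids`
= stream labels prints instead the POOLED ratio `Σ_i e^{−W_i} f(e(ω_i)) / Σ_i e^{−W_i}` over all
records and its delete-one-STREAM jackknife `err` (replicates = pooled ratios leaving one stream
out, centred at their mean; `mean_biascorr = R·mean − (R−1)·m`). THIS file: Crooks pair with `Z₀, Z₁
≠ 0`, `−B ≤ W`, `f` measurable with `|f| ≤ C_f`, `0 < ∫ c² dP_F` (the reweighted observable is not
`P_F`-a.s. degenerate), `K` Markov `ν₀`-invariant dominating a non-zero finite `m` from every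
configuration, `R ≥ 2` INDEPENDENT streams with ANY initial record laws: for every bias-correction
weight `κ` (`0`: `mean`; `R − 1`: `mean_biascorr`) and every `q ≥ 0`, `P(|pooled + κ(pooled − m) −
μ_f| ≤ q·err) → L_R(q) = N(0,1)^{⊗R}{|t| ≤ q}` (as the studentised ratio), `μ_f = Z₁⁻¹ ∫ f dν₁` —
the same universal Student-type limit as every other bar.

* **`CrooksPair.tendsto_measure_abs_pooledReweightedJackknife_le_restartChains`**,
  **`…_everyStart`**.

NOT CLAIMED: unbounded work or observable; unequal stream lengths; dependent streams; contiguous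
blocks of ONE stream; anything numerical.
-/

namespace Summit.Ventures.LatticeQCDFlow.Exactness.GeneralNCMC

open MeasureTheory ProbabilityTheory Set Filter Finset WithLp
open scoped ENNReal NNReal Topology

variable {Ω E : Type*} [MeasurableSpace Ω] [MeasurableSpace E]

/-- `√n (A/n − θ·B/n) = (√n)⁻¹ (A − θ B)` (both sides vanish at `n = 0`). -/
theorem sqrt_mul_div_sub_mul_div_eq (A B θ : ℝ) (n : ℕ) :
    Real.sqrt (n : ℝ) * (A / n - θ * (B / n)) = (Real.sqrt (n : ℝ))⁻¹ * (A - θ * B) := by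
  rcases Nat.eq_zero_or_pos n with hn | hn
  · subst hn; simp
  · have h1 : Real.sqrt (n : ℝ) * (A / n - θ * (B / n)) = Real.sqrt (n : ℝ) / n * (A - θ * B) := by
      ring
    rw [h1, Real.sqrt_div_self', one_div]

namespace CrooksPair

variable {ν₀ ν₁ : Measure Ω} [IsFiniteMeasure ν₀] [IsFiniteMeasure ν₁] {κF κR : Kernel Ω E}
  [IsMarkovKernel κF] [IsMarkovKernel κR] {s e : E → Ω} {W : E → ℝ}
  {ι : Type*} [Fintype ι] [DecidableEq ι] [Nontrivial ι]

/-- **THE ENGINE'S POOLED `reweighted_mean (+ κ·(mean − m)) ± q·err` OVER `R ≥ 2` INDEPENDENT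
STREAMS OF CORRELATED LAUNCHES HAS LIMITING COVERAGE `L_R(q)`.** -/
theorem tendsto_measure_abs_pooledReweightedJackknife_le_restartChains (K : Kernel Ω Ω)
    [IsMarkovKernel K] (h0 : ν₀ univ ≠ 0) (h1 : ν₁ univ ≠ 0) (hK : Kernel.Invariant K ν₀)
    (h : CrooksPair ν₀ ν₁ κF κR s e W) {m : Measure Ω} [IsFiniteMeasure m] (hm0 : m univ ≠ 0)
    (hmin : ∀ z, m ≤ K z) {B : ℝ} (hB : ∀ ω, -B ≤ W ω) {f : Ω → ℝ} (hfm : Measurable f) {Cf : ℝ}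
    (hCf : ∀ y, |f y| ≤ Cf)
    (hV : 0 < ∫ ω, (Real.exp (-W ω) * (f (e ω) - ((ν₁ univ)⁻¹).toReal * ∫ y, f y ∂ν₁)) ^ 2
      ∂(fwdPathLaw ν₀ κF))
    (μ : ι → Measure E) [∀ r, IsProbabilityMeasure (μ r)]
    [∀ r, IsProbabilityMeasure (Kernel.trajMeasure (X := fun _ : ℕ => E) (μ r)
        (fun n : ℕ => ((κF ∘ₖ K).comap s h.measurable_s).comap
          (fun hh : (j : ↥(Finset.Iic n)) → E => hh ⟨n, Finset.mem_Iic.2 le_rfl⟩)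
          (measurable_pi_apply _)))] (κ : ℝ) {q : ℝ} (hq : 0 ≤ q) :
    Tendsto (fun n : ℕ => (Measure.pi fun r => Kernel.trajMeasure (X := fun _ : ℕ => E) (μ r)
        (fun n : ℕ => ((κF ∘ₖ K).comap s h.measurable_s).comap
          (fun hh : (j : ↥(Finset.Iic n)) → E => hh ⟨n, Finset.mem_Iic.2 le_rfl⟩)
          (measurable_pi_apply _)))
        {ω : ι → ℕ → E |
          |((∑ r, ∑ i ∈ range n, Real.exp (-W (ω r i)) * f (e (ω r i)))
                / (∑ r, ∑ i ∈ range n, Real.exp (-W (ω r i)))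
              + κ * ((∑ r, ∑ i ∈ range n, Real.exp (-W (ω r i)) * f (e (ω r i)))
                  / (∑ r, ∑ i ∈ range n, Real.exp (-W (ω r i)))
                - (∑ t, (∑ r ∈ univ.erase t, ∑ i ∈ range n, Real.exp (-W (ω r i)) * f (e (ω r i)))
                    / (∑ r ∈ univ.erase t, ∑ i ∈ range n, Real.exp (-W (ω r i))))
                  / Fintype.card ι)
              - ((ν₁ univ)⁻¹).toReal * ∫ y, f y ∂ν₁)
            / Real.sqrt (((Fintype.card ι : ℝ) - 1) / Fintype.card ι
              * ∑ r, ((∑ u ∈ univ.erase r, ∑ i ∈ range n, Real.exp (-W (ω u i)) * f (e (ω u i)))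
                    / (∑ u ∈ univ.erase r, ∑ i ∈ range n, Real.exp (-W (ω u i)))
                - (∑ t, (∑ u ∈ univ.erase t, ∑ i ∈ range n, Real.exp (-W (ω u i)) * f (e (ω u i)))
                    / (∑ u ∈ univ.erase t, ∑ i ∈ range n, Real.exp (-W (ω u i))))
                  / Fintype.card ι) ^ 2)| ≤ q})
      atTop
      (𝓝 ((Measure.pi fun _ : ι => gaussianReal 0 1) {z : ι → ℝ | |(∑ r, z r) / Fintype.card ι
        / Real.sqrt ((∑ r, (z r - (∑ r', z r') / Fintype.card ι) ^ 2)
            / ((Fintype.card ι : ℝ) * (Fintype.card ι - 1)))| ≤ q})) := by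
  haveI := isProbabilityMeasure_fwdPathLaw ν₀ h0 κF
  set P : (r : ι) → Measure (ℕ → E) := fun r => Kernel.trajMeasure (X := fun _ : ℕ => E) (μ r)
    (fun n : ℕ => ((κF ∘ₖ K).comap s h.measurable_s).comap
      (fun hh : (j : ↥(Finset.Iic n)) → E => hh ⟨n, Finset.mem_Iic.2 le_rfl⟩)
      (measurable_pi_apply _)) with hP
  set θZ : ℝ := ((ν₀ univ)⁻¹ * ν₁ univ).toReal with hθZ
  set μf : ℝ := ((ν₁ univ)⁻¹).toReal * ∫ y, f y ∂ν₁ with hμf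
  have hθZpos : 0 < θZ :=
    ENNReal.toReal_pos (mul_ne_zero (ENNReal.inv_ne_zero.2 (measure_ne_top ν₀ univ)) h1)
      (ENNReal.mul_ne_top (ENNReal.inv_ne_top.2 h0) (measure_ne_top ν₁ univ))
  -- the record observable `c = e^{−W}(f∘e − μ_f)`: measurable, bounded, `E_F c = 0`
  set c : E → ℝ := fun ω => Real.exp (-W ω) * (f (e ω) - μf) with hc
  have hwm : Measurable fun ε => Real.exp (-W ε) := Real.measurable_exp.comp h.measurable_W.neg
  have hcm : Measurable c := hwm.mul ((hfm.comp h.measurable_e).sub measurable_const)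
  have hcb : ∀ ω, |c ω| ≤ Real.exp B * (Cf + |μf|) := fun ω => by
    rw [hc]
    dsimp only
    rw [abs_mul, abs_of_pos (Real.exp_pos _)]
    exact mul_le_mul (Real.exp_le_exp.2 (by linarith [hB ω]))
      ((abs_sub _ _).trans (add_le_add (hCf _) le_rfl)) (abs_nonneg _) (Real.exp_pos _).le
  have hc0 : ∫ ω, c ω ∂(fwdPathLaw ν₀ κF) = 0 := by
    have key := h.integral_exp_neg_work_mul_comp_end (f := fun y => f y - μf)
      (hfm.sub measurable_const).aestronglyMeasurable
    have hint : ∫ y, (f y - μf) ∂ν₁ = ∫ y, f y ∂ν₁ - ν₁.real univ * μf := by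
      rw [integral_sub (Scoring.integrable_of_bounded ν₁ hfm hCf) (integrable_const _),
        integral_const, smul_eq_mul]
    rw [hc]
    dsimp only
    rw [key, hint, hμf, measureReal_def]
    simp only [ENNReal.toReal_inv]
    have hz : (ν₁ univ).toReal ≠ 0 := ENNReal.toReal_ne_zero.2 ⟨h1, measure_ne_top _ _⟩
    field_simp
    ring
  -- the Green–Kubo variance of `c` along the restart chain is positive
  set σ2 : ℝ := (∫ ω, (c ω) ^ 2 ∂(fwdPathLaw ν₀ κF))
      + 2 * ∑' k, ∫ ω, c ω * (Scoring.kop ((κF ∘ₖ K).comap s h.measurable_s))^[k + 1] c ω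
          ∂(fwdPathLaw ν₀ κF) with hσ2
  have hσ2pos : 0 < σ2 := by
    have key := h.reweightVariance_pos_iff K h0 hK hm0 hmin hB hfm hCf
    have hc0' : ∫ z, Real.exp (-W z) * (f (e z) - ((ν₁ univ)⁻¹).toReal * ∫ y, f y ∂ν₁)
        ∂(fwdPathLaw ν₀ κF) = 0 := hc0
    simp only [hc0', sub_zero] at key
    have hV' := key.2 hV
    unfold Scoring.autocov at hV'
    simp only [Function.iterate_zero, id_eq] at hV'
    rw [hσ2]
    convert hV' using 2
    · exact integral_congr_ae (Eventually.of_forall fun ω => by rw [hc]; dsimp only; ring)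
  have hv : σ2.toNNReal ≠ 0 := by
    rw [Ne, Real.toNNReal_eq_zero, not_le]; exact hσ2pos
  -- per-stream CLT for `√n (X_n − μ_f Y_n) = (√n)⁻¹ Σ_{i<n} c(ω_i)`
  have hclt : ∀ r : ι, TendstoInDistribution (fun (n : ℕ) (ω : ℕ → E) =>
        Real.sqrt (n : ℝ) * ((∑ i ∈ range n, Real.exp (-W (ω i)) * f (e (ω i))) / n
          - μf * ((∑ i ∈ range n, Real.exp (-W (ω i))) / n)))
      atTop id (fun _ => P r) (gaussianReal 0 σ2.toNNReal) := by
    intro r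
    have hX := h.tendstoInDistribution_timeAverage_restartChain K h0 hK hm0 hmin hcm hcb (μ r)
      (P' := gaussianReal 0 σ2.toNNReal) (Y := id) ?_
    · simp_rw [hc0, sub_zero] at hX
      refine hX.congr (fun n => Eventually.of_forall fun ω => ?_) Filter.EventuallyEq.rfl
      show _ = Real.sqrt (n : ℝ) * (_ / (n : ℝ) - μf * (_ / (n : ℝ)))
      rw [sqrt_mul_div_sub_mul_div_eq]
      congr 1
      rw [Finset.mul_sum, ← Finset.sum_sub_distrib]
      exact Finset.sum_congr rfl fun i _ => by rw [hc]; dsimp only; ring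
    · simp_rw [hc0, sub_zero]
      exact HasLaw.id
  have hXm : ∀ n : ℕ, Measurable fun ω : ℕ → E =>
      (∑ i ∈ range n, Real.exp (-W (ω i)) * f (e (ω i))) / n := fun n =>
    (Finset.measurable_sum _ fun i _ => (hwm.comp (measurable_pi_apply i)).mul
      (hfm.comp (h.measurable_e.comp (measurable_pi_apply i)))).div_const _
  have hYm1 : ∀ n : ℕ, Measurable fun ω : ℕ → E => (∑ i ∈ range n, Real.exp (-W (ω i))) / n :=
    fun n => (Finset.measurable_sum _ fun i _ => hwm.comp (measurable_pi_apply i)).div_const _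
  have hvec := tendstoInDistribution_pi_toLp (Ω := fun _ : ι => ℕ → E) (P := P)
    (X := fun (_ : ι) (n : ℕ) (ω : ℕ → E) =>
      Real.sqrt (n : ℝ) * ((∑ i ∈ range n, Real.exp (-W (ω i)) * f (e (ω i))) / n
        - μf * ((∑ i ∈ range n, Real.exp (-W (ω i))) / n)))
    (fun _ n => measurable_const.mul ((hXm n).sub ((hYm1 n).const_mul μf))) hclt
  -- the weight block means converge in probability to `Z₁/Z₀ > 0`, stream by stream
  have hYb : ∀ r : ι, TendstoInMeasure (Measure.pi P)
      (fun (n : ℕ) (ω : ι → ℕ → E) => (∑ i ∈ range n, Real.exp (-W (ω r i))) / n)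
      atTop (fun _ => θZ) := by
    intro r
    have hae := h.tendsto_sampleMean_restartChain_anyLaw K h0 hK hm0 hmin (μ r)
    have hae' : ∀ᵐ ω ∂(Measure.pi P), Tendsto (fun n : ℕ =>
        (∑ i ∈ range n, Real.exp (-W (ω r i))) / n) atTop (𝓝 θZ) :=
      (measurePreserving_eval P r).quasiMeasurePreserving.ae hae
    exact tendstoInMeasure_of_tendsto_ae
      (fun n => ((hYm1 n).comp (measurable_pi_apply r)).aestronglyMeasurable) hae'
  -- the pooled-ratio jackknife theorem
  have hmain := tendsto_measure_abs_pooledRatioJackknife_le (P := Measure.pi P)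
    (X := fun (n : ℕ) (ω : ι → ℕ → E) (r : ι) =>
      (∑ i ∈ range n, Real.exp (-W (ω r i)) * f (e (ω r i))) / n)
    (Y := fun (n : ℕ) (ω : ι → ℕ → E) (r : ι) => (∑ i ∈ range n, Real.exp (-W (ω r i))) / n)
    (fun n => measurable_pi_lambda _ fun r => (hYm1 n).comp (measurable_pi_apply r))
    (fun n ω r hn => div_pos (sum_pos (fun i _ => Real.exp_pos _)
      (Finset.nonempty_range_iff.2 (Nat.pos_iff_ne_zero.1 hn))) (by exact_mod_cast hn))
    (θ := μf) hθZpos.ne' hv hvec hYb κ hq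
  -- sums of block means over streams are the pooled sums over all records, up to the factor `n`
  refine hmain.congr' ?_
  filter_upwards [eventually_gt_atTop 0] with n hn
  have hn' : (n : ℝ) ≠ 0 := by exact_mod_cast hn.ne'
  congr 1
  ext ω
  simp only [Set.mem_setOf_eq, ← Finset.sum_div, div_div_div_cancel_right₀ hn']

/-- **The engine's form**: stream `r` launched from ANY configuration `x_r` (`μ_r = κF(x_r, ·)`). -/
theorem tendsto_measure_abs_pooledReweightedJackknife_le_restartChains_everyStart (K : Kernel Ω Ω)
    [IsMarkovKernel K] (h0 : ν₀ univ ≠ 0) (h1 : ν₁ univ ≠ 0) (hK : Kernel.Invariant K ν₀)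
    (h : CrooksPair ν₀ ν₁ κF κR s e W) {m : Measure Ω} [IsFiniteMeasure m] (hm0 : m univ ≠ 0)
    (hmin : ∀ z, m ≤ K z) {B : ℝ} (hB : ∀ ω, -B ≤ W ω) {f : Ω → ℝ} (hfm : Measurable f) {Cf : ℝ}
    (hCf : ∀ y, |f y| ≤ Cf)
    (hV : 0 < ∫ ω, (Real.exp (-W ω) * (f (e ω) - ((ν₁ univ)⁻¹).toReal * ∫ y, f y ∂ν₁)) ^ 2
      ∂(fwdPathLaw ν₀ κF))
    (x : ι → Ω)
    [∀ r, IsProbabilityMeasure (Kernel.trajMeasure (X := fun _ : ℕ => E) (κF (x r))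
        (fun n : ℕ => ((κF ∘ₖ K).comap s h.measurable_s).comap
          (fun hh : (j : ↥(Finset.Iic n)) → E => hh ⟨n, Finset.mem_Iic.2 le_rfl⟩)
          (measurable_pi_apply _)))] (κ : ℝ) {q : ℝ} (hq : 0 ≤ q) :
    Tendsto (fun n : ℕ => (Measure.pi fun r => Kernel.trajMeasure (X := fun _ : ℕ => E) (κF (x r))
        (fun n : ℕ => ((κF ∘ₖ K).comap s h.measurable_s).comap
          (fun hh : (j : ↥(Finset.Iic n)) → E => hh ⟨n, Finset.mem_Iic.2 le_rfl⟩)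
          (measurable_pi_apply _)))
        {ω : ι → ℕ → E |
          |((∑ r, ∑ i ∈ range n, Real.exp (-W (ω r i)) * f (e (ω r i)))
                / (∑ r, ∑ i ∈ range n, Real.exp (-W (ω r i)))
              + κ * ((∑ r, ∑ i ∈ range n, Real.exp (-W (ω r i)) * f (e (ω r i)))
                  / (∑ r, ∑ i ∈ range n, Real.exp (-W (ω r i)))
                - (∑ t, (∑ r ∈ univ.erase t, ∑ i ∈ range n, Real.exp (-W (ω r i)) * f (e (ω r i)))
                    / (∑ r ∈ univ.erase t, ∑ i ∈ range n, Real.exp (-W (ω r i))))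
                  / Fintype.card ι)
              - ((ν₁ univ)⁻¹).toReal * ∫ y, f y ∂ν₁)
            / Real.sqrt (((Fintype.card ι : ℝ) - 1) / Fintype.card ι
              * ∑ r, ((∑ u ∈ univ.erase r, ∑ i ∈ range n, Real.exp (-W (ω u i)) * f (e (ω u i)))
                    / (∑ u ∈ univ.erase r, ∑ i ∈ range n, Real.exp (-W (ω u i)))
                - (∑ t, (∑ u ∈ univ.erase t, ∑ i ∈ range n, Real.exp (-W (ω u i)) * f (e (ω u i)))
                    / (∑ u ∈ univ.erase t, ∑ i ∈ range n, Real.exp (-W (ω u i))))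
                  / Fintype.card ι) ^ 2)| ≤ q})
      atTop
      (𝓝 ((Measure.pi fun _ : ι => gaussianReal 0 1) {z : ι → ℝ | |(∑ r, z r) / Fintype.card ι
        / Real.sqrt ((∑ r, (z r - (∑ r', z r') / Fintype.card ι) ^ 2)
            / ((Fintype.card ι : ℝ) * (Fintype.card ι - 1)))| ≤ q})) :=
  h.tendsto_measure_abs_pooledReweightedJackknife_le_restartChains K h0 h1 hK hm0 hmin hB hfm hCf hV
    (fun r => κF (x r)) κ hq

end CrooksPair

end Summit.Ventures.LatticeQCDFlow.Exactness.GeneralNCMC
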